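import Summits.ValiantsHypothesis.ValiantsHypothesis.Theses.NewtonUnitEquations
import Literature.Computability.AlgebraicComplexity.NewtonPolygonTau

/-!
# Hrubeš transfer for `TwoProducts` (val-idea-37 g8, crux `stmt-ValiantsHypothesis-5906`)

**VP ≠ VNP is NOT proved. `TwoProducts` stays OPEN.** This file proves nothing about the crux except two
REDUCTIONS of it to purely univariate statements, modulo one named fact each (Hrubeš 2020, Theorems 2 and 3,
stated hypothesis-style as `def … : Prop`, never asserted):

* `twoProducts_of_biasLaw     : HrubesNewtonBias     → TwoProductsBiasLaw     → TwoProducts`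
* `twoProducts_of_realPartLaw : HrubesNewtonRealPart → TwoProductsRealPartLaw → TwoProducts`

Source. P. Hrubeš, *On the distribution of runners on a circle*, European J. Combin. 89 (2020) 103137,
arXiv:1906.02511: Theorem 2 (p. 4 of the arXiv text): if `Newt(f)` has `k` vertices then for some
`a ∈ ℂ ∖ {0}` the univariate `f(x,a)` has angular bias `B(f(x,a)) ≥ Ω(√k)`; Theorem 3 (ibid.): for some
`a ∈ ℂ ∖ {0}`, `re(f(x,a)) = Σ_i Re(c_i) x^i` has `Ω(k)` distinct real roots; Proposition 4 (ibid.): the Real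
τ-Conjecture implies the τ-Conjecture for Newton polygons. The substitution `y ↦ a` maps the class
`{∏_{j<m} f_j − ∏_{j<m} g_j : f_j, g_j t-sparse bivariate}` INTO the class `{∏ F_j − ∏ G_j : F_j, G_j t-sparse
univariate}` (`substY`, `card_support_substY_le`), and the currency `2^(a·m)·(t+2)^b` of `TwoProducts` absorbs
Hrubeš's quadratic loss, so the two univariate laws below each imply the crux.

The laws (`TwoProductsBiasLaw`, `TwoProductsRealPartLaw`) are OPEN statements (candidate stronger forms C⁺ of
the crux); see the memo `HrubesTransfer-val-idea-37-g8.md` for why they might fail, what is known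
(`m = 1`: Descartes / argument principle; in general only the trivial `O(t^m)`), and how they sit between
`Literature…KoiranRealTauConjecture` and the crux.
-/

set_option linter.dupNamespace false

noncomputable section

open scoped BigOperators
open Polynomial

namespace Summit.ValiantsHypothesis.ValiantsHypothesis.Cruxes.TwoProducts.HrubesTransfer

open Literature.Computability.AlgebraicComplexity (newtonVertexCount)

/-! ## The substitution `y ↦ a` -/

/-- `f(x,y) ↦ f(x,a) ∈ ℂ[X]`: the `ℂ`-algebra map `X 0 ↦ X`, `X 1 ↦ C a`. -/
def substY (a : ℂ) : MvPolynomial (Fin 2) ℂ →ₐ[ℂ] ℂ[X] :=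
  MvPolynomial.aeval ![(X : ℂ[X]), C a]

theorem substY_monomial (a : ℂ) (e : Fin 2 →₀ ℕ) (c : ℂ) :
    substY a (MvPolynomial.monomial e c) = Polynomial.monomial (e 0) (c * a ^ (e 1)) := by
  unfold substY
  rw [MvPolynomial.aeval_monomial, Finsupp.prod_fintype _ _ (fun i => by simp), Fin.prod_univ_two,
    ← Polynomial.C_eq_algebraMap, ← Polynomial.C_mul_X_pow_eq_monomial, Polynomial.C_mul, Polynomial.C_pow]
  simp only [Matrix.cons_val_zero, Matrix.cons_val_one]
  ring

/-- The `x`-support of `f(x,a)` is contained in the projection of the support of `f`. -/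
theorem support_substY_subset (a : ℂ) (p : MvPolynomial (Fin 2) ℂ) :
    (substY a p).support ⊆ p.support.image (fun e => e 0) := by
  classical
  intro n hn
  rw [p.as_sum, map_sum, Polynomial.mem_support_iff, Polynomial.finsetSum_coeff] at hn
  by_contra hnot
  apply hn
  refine Finset.sum_eq_zero fun e he => ?_
  rw [substY_monomial, Polynomial.coeff_monomial, if_neg]
  rintro rfl
  exact hnot (Finset.mem_image.mpr ⟨e, he, rfl⟩)

/-- Substitution does not increase the number of monomials. -/
theorem card_support_substY_le (a : ℂ) (p : MvPolynomial (Fin 2) ℂ) :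
    (substY a p).support.card ≤ p.support.card := by
  classical
  exact (Finset.card_le_card (support_substY_subset a p)).trans Finset.card_image_le

theorem substY_twoProducts (a : ℂ) {m : ℕ} (f g : Fin m → MvPolynomial (Fin 2) ℂ) :
    substY a (∏ j, f j - ∏ j, g j) = ∏ j, substY a (f j) - ∏ j, substY a (g j) := by
  rw [map_sub, map_prod, map_prod]

/-! ## Angular bias of the nonzero roots (Hrubeš 2020, §2) -/

/-- The argument normalised to `[0, 2π)`. -/
def arg₀ (z : ℂ) : ℝ := if Complex.arg z < 0 then Complex.arg z + 2 * Real.pi else Complex.arg z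

/-- `N_{α,β}(p)`: the number of nonzero roots of `p` (with multiplicity) in the closed sector
`{r e^{iθ} : r > 0, α ≤ θ ≤ β}` (`θ` normalised to `[0,2π)`). -/
def sectorCount (p : ℂ[X]) (α β : ℝ) : ℕ := by
  classical
  exact (p.roots.filter (fun z => z ≠ 0 ∧ α ≤ arg₀ z ∧ arg₀ z ≤ β)).card

/-- `n(p)`: the number of nonzero roots of `p`, with multiplicity. -/
def nonzeroRootCount (p : ℂ[X]) : ℕ := by
  classical
  exact (p.roots.filter (fun z => z ≠ 0)).card

/-- The deviation `|N_{α,β}(p) − n(p)(β − α)/2π|` of one sector; Hrubeš's bias `B(p)` is its `sup` over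
`0 ≤ α ≤ β ≤ 2π` (p. 4). -/
def sectorDeviation (p : ℂ[X]) (α β : ℝ) : ℝ :=
  |(sectorCount p α β : ℝ) - (nonzeroRootCount p : ℝ) * (β - α) / (2 * Real.pi)|

/-- NAMED FACT (theorem in print, unformalised; used only as a hypothesis) — **Hrubeš 2020, Theorem 2**:
"Let `f(x,y)` be a bivariate complex polynomial such that `Newt(f)` has `k` vertices. Then there exists
`a ∈ ℂ ∖ {0}` such that the univariate polynomial `f(x,a)` satisfies `B(f(x,a)) ≥ Ω(√k)`" (with the paper's
footnote: `≥ c·√k` for some constant `c > 0` and every sufficiently large `k`). Recorded with the `sup` in `B`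
opened into `∃ α β` (equivalent up to halving `c`).
[cite: Hrubes2020Runners, Theorem 2 (arXiv:1906.02511, p. 4)] -/
def HrubesNewtonBias : Prop :=
  ∃ c : ℝ, 0 < c ∧ ∃ k₀ : ℕ, ∀ f : MvPolynomial (Fin 2) ℂ, k₀ ≤ newtonVertexCount f →
    ∃ a : ℂ, a ≠ 0 ∧ ∃ α β : ℝ, 0 ≤ α ∧ α ≤ β ∧ β ≤ 2 * Real.pi ∧
      c * Real.sqrt (newtonVertexCount f) ≤ sectorDeviation (substY a f) α β

/-- CANDIDATE STRONGER FORM C⁺ of the crux (OPEN; a statement, not a claim) — **two-products bias law**: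
the angular bias of `∏_{j<m} F_j − ∏_{j<m} G_j`, `F_j, G_j ∈ ℂ[x]` with at most `t` monomials each, is at
most `2^(a·m)·(t+2)^b`. Known: `m ≤ 1` (a `2t`-nomial: argument principle on a truncated sector plus
Descartes on the two boundary rays gives deviation `≤ 2t + O(1)`); one product of `m` factors (deviation is
subadditive over factors); in general only the trivial `O(t^m)`. Implied (with a polynomial bound) by the
Real τ-Conjecture via Hrubeš, Theory Comput. 9 (2013); implies, by `x ↦ x^N`, the same bound for the roots of
`∏ F_j − ∏ G_j` on any ray, i.e. an exponential-slack form of the `k = 2` case of the Real τ-Conjecture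
(Koiran 2011, §6: "the case `k = 2` already looks nontrivial"). -/
def TwoProductsBiasLaw : Prop :=
  ∃ a b : ℕ, ∀ (m t : ℕ) (F G : Fin m → ℂ[X]),
    (∀ j, (F j).support.card ≤ t) → (∀ j, (G j).support.card ≤ t) →
    ∀ α β : ℝ, 0 ≤ α → α ≤ β → β ≤ 2 * Real.pi →
      sectorDeviation (∏ j, F j - ∏ j, G j) α β ≤ (2 : ℝ) ^ (a * m) * ((t : ℝ) + 2) ^ b

/-! ## Real parts (Hrubeš 2020, Theorem 3) -/

/-- `re(p) = Σ_i Re(c_i) x^i ∈ ℝ[x]` for `p = Σ_i c_i x^i ∈ ℂ[x]` (Hrubeš 2020, before Theorem 3). -/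
def rePart (p : ℂ[X]) : ℝ[X] :=
  p.sum fun n c => Polynomial.monomial n c.re

/-- NAMED FACT (theorem in print, unformalised; used only as a hypothesis) — **Hrubeš 2020, Theorem 3**:
"Let `f(x,y)` be a complex polynomial such that its Newton polytope has `k` vertices. Then there exists
`a ∈ ℂ ∖ {0}` such that `re(f(x,a))` has `Ω(k)` distinct real roots." (Proof, §5.3: `≥ (s−1)/8` sign changes
on disjoint intervals, `s ≥ (k−2)/2`; in particular `re(f(x,a)) ≠ 0`, so Mathlib's `roots` — empty for the zero
polynomial — transcribes "distinct real roots" faithfully.)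
[cite: Hrubes2020Runners, Theorem 3 (arXiv:1906.02511, pp. 4, 11–12)] -/
def HrubesNewtonRealPart : Prop :=
  ∃ c : ℝ, 0 < c ∧ ∃ k₀ : ℕ, ∀ f : MvPolynomial (Fin 2) ℂ, k₀ ≤ newtonVertexCount f →
    ∃ a : ℂ, a ≠ 0 ∧ c * (newtonVertexCount f : ℝ) ≤ ((rePart (substY a f)).roots.toFinset.card : ℝ)

/-- CANDIDATE STRONGER FORM C⁺′ of the crux (OPEN; a statement, not a claim) — **two-products real-part
law**: `re(∏_{j<m} F_j − ∏_{j<m} G_j)`, `F_j, G_j ∈ ℂ[x]` with at most `t` monomials each, has at most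
`2^(a·m)·(t+2)^b` distinct real roots. Writing `F_j = P_j + i Q_j` it is a signed sum of `2^m` products of `m`
real `t`-sparse polynomials, so it is implied by `KoiranRealTauConjecture` (bound `(2^(m+1)+m+t+2)^c ≤
2^(c(m+3))(t+2)^c`); it implies `TwoProductsBiasLaw` up to constants (argument principle on the two boundary
rays of a sector, the class being closed under `x ↦ e^{iα} x`). -/
def TwoProductsRealPartLaw : Prop :=
  ∃ a b : ℕ, ∀ (m t : ℕ) (F G : Fin m → ℂ[X]),
    (∀ j, (F j).support.card ≤ t) → (∀ j, (G j).support.card ≤ t) →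
      (rePart (∏ j, F j - ∏ j, G j)).roots.toFinset.card ≤ 2 ^ (a * m) * (t + 2) ^ b

/-! ## The transfers -/

private theorem exists_two_pow_ge (x : ℝ) : ∃ d : ℕ, x ≤ (2 : ℝ) ^ d := by
  obtain ⟨d, hd⟩ := exists_nat_gt x
  refine ⟨d, hd.le.trans ?_⟩
  exact_mod_cast (Nat.lt_two_pow_self (n := d)).le

private theorem small_case {k k₀ t A e : ℕ} (hk : k < k₀) (hA : 1 ≤ A) (he : k₀ ≤ e) :
    k ≤ A * (t + 2) ^ e := by
  have h1 : k₀ ≤ 2 ^ k₀ := (Nat.lt_two_pow_self).le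
  have h2 : 2 ^ k₀ ≤ (t + 2) ^ k₀ := Nat.pow_le_pow_left (by omega) k₀
  have h3 : (t + 2) ^ k₀ ≤ (t + 2) ^ e := Nat.pow_le_pow_right (by omega) he
  calc k ≤ (t + 2) ^ e := by omega
    _ ≤ A * (t + 2) ^ e := Nat.le_mul_of_pos_left _ hA

/-- **Transfer via Theorem 2.** The two-products bias law implies the crux `TwoProducts`
(constants: `(a, b) ↦ (2a, 2b + d + k₀)` with `2^d ≥ 1/c²`). -/
theorem twoProducts_of_biasLaw (hH : HrubesNewtonBias) (hL : TwoProductsBiasLaw) :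
    Theses.NewtonUnitEquations.TwoProducts := by
  obtain ⟨c, hc, k₀, hH⟩ := hH
  obtain ⟨a, b, hL⟩ := hL
  obtain ⟨d, hd⟩ := exists_two_pow_ge (1 / c ^ 2)
  refine ⟨2 * a, 2 * b + d + k₀, fun m t f g hf hg => ?_⟩
  change newtonVertexCount (∏ j, f j - ∏ j, g j) ≤ _
  set k := newtonVertexCount (∏ j, f j - ∏ j, g j) with hk
  by_cases hsmall : k < k₀
  · exact small_case hsmall Nat.one_le_two_pow (by omega)
  obtain ⟨α₀, -, α, β, h0α, hαβ, hβ, hdev⟩ := hH _ (not_lt.mp hsmall)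
  rw [substY_twoProducts] at hdev
  have hbound := hL m t (fun j => substY α₀ (f j)) (fun j => substY α₀ (g j))
    (fun j => (card_support_substY_le _ _).trans (hf j)) (fun j => (card_support_substY_le _ _).trans (hg j))
    α β h0α hαβ hβ
  set B : ℝ := (2 : ℝ) ^ (a * m) * ((t : ℝ) + 2) ^ b with hB
  have h1 : c * Real.sqrt k ≤ B := hdev.trans hbound
  have hk0 : (0 : ℝ) ≤ k := Nat.cast_nonneg _
  have hsq : c ^ 2 * (k : ℝ) ≤ B ^ 2 := by
    have h0 : 0 ≤ c * Real.sqrt k := by positivity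
    have h2 := mul_self_le_mul_self h0 h1
    have e1 : c * Real.sqrt k * (c * Real.sqrt k) = c ^ 2 * k := by
      rw [mul_mul_mul_comm, Real.mul_self_sqrt hk0]; ring
    rw [e1] at h2
    nlinarith [h2]
  have hc2 : 0 < c ^ 2 := by positivity
  have hkR : (k : ℝ) ≤ (2 : ℝ) ^ (2 * a * m) * ((t : ℝ) + 2) ^ (2 * b + d) := by
    have step1 : (k : ℝ) ≤ B ^ 2 * (1 / c ^ 2) := by
      rw [mul_one_div, le_div_iff₀ hc2]
      linarith [hsq]
    have step2 : B ^ 2 * (1 / c ^ 2) ≤ B ^ 2 * (2 : ℝ) ^ d :=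
      mul_le_mul_of_nonneg_left hd (by positivity)
    have ht2 : (2 : ℝ) ≤ (t : ℝ) + 2 := by linarith [(Nat.cast_nonneg t : (0 : ℝ) ≤ t)]
    have step3 : (2 : ℝ) ^ d ≤ ((t : ℝ) + 2) ^ d := pow_le_pow_left₀ (by norm_num) ht2 d
    calc (k : ℝ) ≤ B ^ 2 * (1 / c ^ 2) := step1
      _ ≤ B ^ 2 * (2 : ℝ) ^ d := step2
      _ ≤ B ^ 2 * ((t : ℝ) + 2) ^ d := mul_le_mul_of_nonneg_left step3 (by positivity)
      _ = (2 : ℝ) ^ (2 * a * m) * ((t : ℝ) + 2) ^ (2 * b + d) := by rw [hB]; ring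
  have hkN : k ≤ 2 ^ (2 * a * m) * (t + 2) ^ (2 * b + d) := by exact_mod_cast hkR
  calc k ≤ 2 ^ (2 * a * m) * (t + 2) ^ (2 * b + d) := hkN
    _ ≤ 2 ^ (2 * a * m) * (t + 2) ^ (2 * b + d + k₀) :=
      Nat.mul_le_mul_left _ (Nat.pow_le_pow_right (by omega) (by omega))

/-- **Transfer via Theorem 3.** The two-products real-part law implies the crux `TwoProducts`
(constants: `(a, b) ↦ (a, b + d + k₀)` with `2^d ≥ 1/c`). -/
theorem twoProducts_of_realPartLaw (hH : HrubesNewtonRealPart) (hL : TwoProductsRealPartLaw) :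
    Theses.NewtonUnitEquations.TwoProducts := by
  obtain ⟨c, hc, k₀, hH⟩ := hH
  obtain ⟨a, b, hL⟩ := hL
  obtain ⟨d, hd⟩ := exists_two_pow_ge (1 / c)
  refine ⟨a, b + d + k₀, fun m t f g hf hg => ?_⟩
  change newtonVertexCount (∏ j, f j - ∏ j, g j) ≤ _
  set k := newtonVertexCount (∏ j, f j - ∏ j, g j) with hk
  by_cases hsmall : k < k₀
  · exact small_case hsmall Nat.one_le_two_pow (by omega)
  obtain ⟨α₀, -, hroots⟩ := hH _ (not_lt.mp hsmall)
  rw [substY_twoProducts] at hroots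
  have hbound := hL m t (fun j => substY α₀ (f j)) (fun j => substY α₀ (g j))
    (fun j => (card_support_substY_le _ _).trans (hf j)) (fun j => (card_support_substY_le _ _).trans (hg j))
  set B : ℕ := 2 ^ (a * m) * (t + 2) ^ b with hB
  have h1 : c * (k : ℝ) ≤ (B : ℝ) := hroots.trans (by exact_mod_cast hbound)
  have hkR : (k : ℝ) ≤ (2 : ℝ) ^ (a * m) * ((t : ℝ) + 2) ^ (b + d) := by
    have step1 : (k : ℝ) ≤ (B : ℝ) * (1 / c) := by
      rw [mul_one_div, le_div_iff₀ hc]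
      linarith [h1]
    have step2 : (B : ℝ) * (1 / c) ≤ (B : ℝ) * (2 : ℝ) ^ d :=
      mul_le_mul_of_nonneg_left hd (by positivity)
    have ht2 : (2 : ℝ) ≤ (t : ℝ) + 2 := by linarith [(Nat.cast_nonneg t : (0 : ℝ) ≤ t)]
    have step3 : (2 : ℝ) ^ d ≤ ((t : ℝ) + 2) ^ d := pow_le_pow_left₀ (by norm_num) ht2 d
    calc (k : ℝ) ≤ (B : ℝ) * (1 / c) := step1
      _ ≤ (B : ℝ) * (2 : ℝ) ^ d := step2
      _ ≤ (B : ℝ) * ((t : ℝ) + 2) ^ d := mul_le_mul_of_nonneg_left step3 (by positivity)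
      _ = (2 : ℝ) ^ (a * m) * ((t : ℝ) + 2) ^ (b + d) := by rw [hB]; push_cast; ring
  have hkN : k ≤ 2 ^ (a * m) * (t + 2) ^ (b + d) := by exact_mod_cast hkR
  calc k ≤ 2 ^ (a * m) * (t + 2) ^ (b + d) := hkN
    _ ≤ 2 ^ (a * m) * (t + 2) ^ (b + d + k₀) :=
      Nat.mul_le_mul_left _ (Nat.pow_le_pow_right (by omega) (by omega))

end Summit.ValiantsHypothesis.ValiantsHypothesis.Cruxes.TwoProducts.HrubesTransfer

end
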